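import Literature.NumberTheory.GaloisRepresentations.ContinuousCorestriction
import Literature.NumberTheory.GaloisRepresentations.ContinuousCohomologyTransport
import Literature.NumberTheory.GaloisRepresentations.InducedGaloisRep
import Literature.NumberTheory.GaloisRepresentations.GaloisCohomology
import HarnessLib

/-!
# The corestriction `Cor_{F/K} : H¹(F, M) → H¹(K, M)` of Galois cohomology along a finite extension
# of fields, and `Cor ∘ Res = [F : K]` (Serre, *Galois Cohomology* I §2.4)

Topic `NumberTheory/GaloisRepresentations`; namespace `Literature.NumberTheory.GaloisRepresentations`.
Definitions with bodies and theorems; no named fact, no instance.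

For a finite extension `F/K` of fields of characteristic `0` (number fields, `p`-adic fields) and a
discrete `Γ_K`-module `M` (`ρ : DiscreteGaloisModule K M`), the tree computes `Hⁿ(F, M)` as the
continuous cohomology of `Γ_F = Gal(F̄/F)` acting through the CHOSEN restriction
`res = absGaloisRestrict K F : Γ_F →ₜ* Γ_K` (`GaloisRep.restrictField`,
`galoisCohomology.res ρ F n : Hⁿ(K, M) → Hⁿ(F, M)`), an open embedding with image
`res(Γ_F) = Gal(K̄/e(F))` of index `[F : K]` (`isOpenEmbedding_absGaloisRestrict`,
`nat_card_quotient_range_absGaloisRestrict`, file `InducedGaloisRep`).  The corestriction of the tree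
lives on subgroups (`cores X N : H¹(N, X) → H¹(G, X)` for an open subgroup `N` of finite index,
`ContinuousCorestriction.lean`).  This file transports it to the FIELD currency:

* `absGaloisRangeEquiv K F : Γ_F ≃ₜ* res(Γ_F)` — the open embedding as an isomorphism onto its image;
* `galoisCohomology.rangeTransport ρ F n : Hⁿ(F, M) ≃+ Hⁿ(res(Γ_F), M)` — transport of cohomology
  along it (`continuousCohomologyAddEquivOfContinuousMulEquiv`), with
  `rangeTransport_res : rangeTransport (res x) = res_{res(Γ_F)} x` (the field restriction IS the
  subgroup restriction);
* **`galoisCohomology.cor ρ F : H¹(F, M) →+ H¹(K, M)`** — `cores` along `res(Γ_F)` after the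
  transport; `cor_eq_cores_rangeTransport` (unfolding);
* **`galoisCohomology.cor_res : Cor_{F/K} (Res_{F/K} x) = [F : K] • x`** (Serre I §2.4 Prop. 9, from
  the tree's `cores_resSubgroup` and `[Γ_K : res(Γ_F)] = [F : K]`).

Consumer: the prime-to-`p` descent of Poitou–Tate middle-exactness (Milne I 4.10(b)) from a finite
extension `K'/K` with `p ∤ [K' : K]` (cell `bsd-stepL`, crux `ZhangSharpFrameAtThreeHL`): there
`x = [K':K]⁻¹ • Cor x'`.

## References

* J.-P. Serre, *Galois Cohomology* (1997), I §2.4 (Res, Cor, Prop. 9 `Cor ∘ Res = n`).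
  [SerreGaloisCohomology1997]
* J. Neukirch, A. Schmidt, K. Wingberg, *Cohomology of Number Fields*, 2nd ed. (2008), I §5
  (Cor 1.5.3, 1.5.6–1.5.7). [NeukirchSchmidtWingberg2008]
-/

noncomputable section

open CategoryTheory Function

universe u w

namespace Literature.NumberTheory.GaloisRepresentations

open Field

/-! ### `Γ_F ≃ₜ* res(Γ_F)` -/

section RangeEquiv

variable (K F : Type u) [Field K] [Field F] [Algebra K F] [CharZero K] [FiniteDimensional K F]

/-- **The open embedding `res : Γ_F → Γ_K` as an isomorphism of topological groups onto its image**
`res(Γ_F) = Gal(K̄/e(F))` (`F/K` finite, characteristic `0`; `absGaloisRestrict_injective`,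
`isOpenEmbedding_absGaloisRestrict`). [cite: SerreGaloisCohomology1997, I §2.4] -/
def absGaloisRangeEquiv : absoluteGaloisGroup F ≃ₜ* (absGaloisRestrict K F).range :=
  have hinj : Function.Injective
      ((absGaloisRestrict K F : absoluteGaloisGroup F →* absoluteGaloisGroup K) :
        absoluteGaloisGroup F → absoluteGaloisGroup K) := absGaloisRestrict_injective K F
  { MonoidHom.ofInjective hinj with
    continuous_toFun := (absGaloisRestrict K F).continuous.subtype_mk _
    continuous_invFun := by
      have hemb := (isOpenEmbedding_absGaloisRestrict K F).isEmbedding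
      rw [hemb.continuous_iff]
      have h : ((absGaloisRestrict K F : absoluteGaloisGroup F →* absoluteGaloisGroup K) :
            absoluteGaloisGroup F → absoluteGaloisGroup K) ∘ (MonoidHom.ofInjective hinj).invFun =
          Subtype.val := by
        funext x
        rw [MulEquiv.invFun_eq_symm]
        exact MonoidHom.apply_ofInjective_symm hinj x
      exact h ▸ continuous_subtype_val }

/-- Unfolding: `absGaloisRangeEquiv K F σ = res σ` in `Γ_K`. [cite: SerreGaloisCohomology1997, I §2.4] -/
@[simp]
theorem absGaloisRangeEquiv_apply_coe (σ : absoluteGaloisGroup F) :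
    ((absGaloisRangeEquiv K F σ : (absGaloisRestrict K F).range) : absoluteGaloisGroup K) =
      absGaloisRestrict K F σ :=
  rfl

/-- Unfolding the inverse: `res ((absGaloisRangeEquiv K F).symm h) = h`.
[cite: SerreGaloisCohomology1997, I §2.4] -/
@[simp]
theorem absGaloisRestrict_absGaloisRangeEquiv_symm (h : (absGaloisRestrict K F).range) :
    absGaloisRestrict K F ((absGaloisRangeEquiv K F).symm h) = (h : absoluteGaloisGroup K) :=
  MonoidHom.apply_ofInjective_symm (absGaloisRestrict_injective K F) h

/-- `res(Γ_F)` has finite index `[F : K]` in `Γ_K`. [cite: SerreGaloisCohomology1997, I §2.4] -/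
theorem index_range_absGaloisRestrict :
    (absGaloisRestrict K F).range.index = Module.finrank K F :=
  nat_card_quotient_range_absGaloisRestrict K F

end RangeEquiv

/-! ### Transport `Hⁿ(F, M) ≃ Hⁿ(res(Γ_F), M)` and the corestriction -/

section Cor

variable {K : Type u} [Field K] [CharZero K] {M : Type u} [AddCommGroup M] [TopologicalSpace M]
  [DiscreteTopology M] (ρ : DiscreteGaloisModule K M)
  (F : Type u) [Field F] [Algebra K F] [FiniteDimensional K F]

/-- The module map (identity of `M`) from `Γ_F` acting through `res` (pulled back along
`(absGaloisRangeEquiv K F)⁻¹`) to the subgroup representation of `res(Γ_F)`.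
[cite: SerreGaloisCohomology1997, I §2.4] -/
def rangeTransportHom :
    TopRep.res (((absGaloisRangeEquiv K F).symm : (absGaloisRestrict K F).range →ₜ* absoluteGaloisGroup F) :
        (absGaloisRestrict K F).range →* absoluteGaloisGroup F)
      (DiscreteGaloisModule.toTopRep (ρ.restrictField F)) ⟶
      subgroupRep ρ.toTopRep (absGaloisRestrict K F).range :=
  TopRep.ofHom ⟨ContinuousLinearMap.id ℤ M, fun h => by
    ext m
    change (ρ.restrictField F) ((absGaloisRangeEquiv K F).symm h) m = ρ (h : absoluteGaloisGroup K) m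
    rw [GaloisRep.restrictField_apply, absGaloisRestrict_absGaloisRangeEquiv_symm]⟩

/-- The module map (identity of `M`) in the other direction. [cite: SerreGaloisCohomology1997, I §2.4] -/
def rangeTransportInv :
    TopRep.res (((absGaloisRangeEquiv K F) : absoluteGaloisGroup F →ₜ* (absGaloisRestrict K F).range) :
        absoluteGaloisGroup F →* (absGaloisRestrict K F).range)
      (subgroupRep ρ.toTopRep (absGaloisRestrict K F).range) ⟶
      DiscreteGaloisModule.toTopRep (ρ.restrictField F) :=
  TopRep.ofHom ⟨ContinuousLinearMap.id ℤ M, fun _ => rfl⟩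

/-- **`Hⁿ(F, M) ≃+ Hⁿ(res(Γ_F), M)`**: the Galois cohomology of `F` with coefficients in the
restricted module is the continuous cohomology of the open subgroup `res(Γ_F) ≤ Γ_K` (transport
along `absGaloisRangeEquiv`). [cite: SerreGaloisCohomology1997, I §2.4] -/
def galoisCohomology.rangeTransport (n : ℕ) :
    galoisCohomology (ρ.restrictField F) n ≃+
      continuousCohomology n (subgroupRep ρ.toTopRep (absGaloisRestrict K F).range) :=
  continuousCohomologyAddEquivOfContinuousMulEquiv (absGaloisRangeEquiv K F)
    (rangeTransportHom ρ F) (rangeTransportInv ρ F) (fun _ => rfl) (fun _ => rfl) n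

/-- Unfolding the transport as a `ContinuousCohomology.map`. [cite: SerreGaloisCohomology1997, I §2.4] -/
theorem galoisCohomology.rangeTransport_apply (n : ℕ) (x : galoisCohomology (ρ.restrictField F) n) :
    galoisCohomology.rangeTransport ρ F n x =
      (ContinuousCohomology.map
        ((absGaloisRangeEquiv K F).symm : (absGaloisRestrict K F).range →ₜ* absoluteGaloisGroup F)
        (rangeTransportHom ρ F) n).hom x :=
  rfl

omit [CharZero K] [FiniteDimensional K F] in
/-- `ContinuousCohomology.map` only depends on the compatible pair pointwise: equal group
homomorphisms and pointwise equal module maps induce the same map on `Hⁿ`.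
[cite: SerreGaloisCohomology1997, I §2.4] -/
theorem ContinuousCohomology.map_congr_of_eq {k : Type w} [Ring k] [TopologicalSpace k]
    {G H : Type u} [Group G] [TopologicalSpace G] [IsTopologicalGroup G] [Group H]
    [TopologicalSpace H] [IsTopologicalGroup H] {X : TopRep.{u} k G} {Y : TopRep.{u} k H}
    {φ φ' : H →ₜ* G} (h : φ = φ') (f : TopRep.res (φ : H →* G) X ⟶ Y)
    (f' : TopRep.res (φ' : H →* G) X ⟶ Y) (hff' : ∀ x : X, f.hom x = f'.hom x) (n : ℕ) :
    ContinuousCohomology.map φ f n = ContinuousCohomology.map φ' f' n := by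
  subst h
  have : f = f' := TopRep.hom_ext (ContIntertwiningMap.ext (ContinuousLinearMap.ext fun x => hff' x))
  rw [this]

/-- **The field restriction is the subgroup restriction**: transporting `Res_{F/K} x ∈ Hⁿ(F, M)` to
`Hⁿ(res(Γ_F), M)` gives `res_{res(Γ_F)} x` (both are `Hⁿ` of the compatible pair
`(res(Γ_F) ↪ Γ_K, id_M)`, by `ContinuousCohomology.map_comp`). [cite: SerreGaloisCohomology1997, I §2.4] -/
theorem galoisCohomology.rangeTransport_res (n : ℕ) (x : galoisCohomology ρ n) :
    galoisCohomology.rangeTransport ρ F n (galoisCohomology.res ρ F n x) =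
      resSubgroup ρ.toTopRep (absGaloisRestrict K F).range n x := by
  set ψ : (absGaloisRestrict K F).range →ₜ* absoluteGaloisGroup F :=
    ((absGaloisRangeEquiv K F).symm : (absGaloisRestrict K F).range →ₜ* absoluteGaloisGroup F) with hψ
  set f : TopRep.res (absGaloisRestrict K F : absoluteGaloisGroup F →* absoluteGaloisGroup K) ρ.toTopRep ⟶
      DiscreteGaloisModule.toTopRep (ρ.restrictField F) :=
    TopRep.ofHom ⟨ContinuousLinearMap.id ℤ M, fun _ => rfl⟩ with hf
  have hcomp := ContinuousCohomology.map_comp (absGaloisRestrict K F) ψ (X := ρ.toTopRep)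
    (Y := DiscreteGaloisModule.toTopRep (ρ.restrictField F))
    (Z := subgroupRep ρ.toTopRep (absGaloisRestrict K F).range) f (rangeTransportHom ρ F) n
  have hφ : (absGaloisRestrict K F).comp ψ = subgroupSubtypeHom (absGaloisRestrict K F).range := by
    ext h
    change absGaloisRestrict K F ((absGaloisRangeEquiv K F).symm h) = (h : absoluteGaloisGroup K)
    exact absGaloisRestrict_absGaloisRangeEquiv_symm K F h
  have hmap : ContinuousCohomology.map ((absGaloisRestrict K F).comp ψ) (X := ρ.toTopRep)
      ((TopRep.resFunctor (ψ : (absGaloisRestrict K F).range →* absoluteGaloisGroup F)).map f ≫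
        rangeTransportHom ρ F) n =
      ContinuousCohomology.map (subgroupSubtypeHom (absGaloisRestrict K F).range) (X := ρ.toTopRep)
        (Y := subgroupRep ρ.toTopRep (absGaloisRestrict K F).range)
        (TopRep.ofHom ⟨ContinuousLinearMap.id ℤ M, fun _ => rfl⟩) n :=
    ContinuousCohomology.map_congr_of_eq hφ _ _ (fun _ => rfl) n
  rw [hmap] at hcomp
  exact (congrArg (fun T => TopModuleCat.Hom.hom T x) hcomp).symm

/-- **The corestriction `Cor_{F/K} : H¹(F, M) →+ H¹(K, M)`** of a discrete `Γ_K`-module along a finite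
extension `F/K` (characteristic `0`): the tree's `cores` (transfer on continuous crossed
homomorphisms) along the open subgroup `res(Γ_F) ≤ Γ_K` of index `[F : K]`, after the transport
`H¹(F, M) ≃ H¹(res(Γ_F), M)`. [cite: SerreGaloisCohomology1997, I §2.4] -/
def galoisCohomology.cor : galoisCohomology (ρ.restrictField F) 1 →+ galoisCohomology ρ 1 :=
  letI : Fintype (absoluteGaloisGroup K ⧸ (absGaloisRestrict K F).range) := Fintype.ofFinite _
  (cores ρ.toTopRep (absGaloisRestrict K F).range (isOpen_range_absGaloisRestrict K F)).toAddMonoidHom.comp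
    (galoisCohomology.rangeTransport ρ F 1).toAddMonoidHom

/-- Unfolding `cor` (for any `Fintype` instance on the coset space).
[cite: SerreGaloisCohomology1997, I §2.4] -/
theorem galoisCohomology.cor_eq_cores_rangeTransport
    [inst : Fintype (absoluteGaloisGroup K ⧸ (absGaloisRestrict K F).range)]
    (y : galoisCohomology (ρ.restrictField F) 1) :
    galoisCohomology.cor ρ F y =
      cores ρ.toTopRep (absGaloisRestrict K F).range (isOpen_range_absGaloisRestrict K F)
        (galoisCohomology.rangeTransport ρ F 1 y) := by
  have h : inst = Fintype.ofFinite _ := Subsingleton.elim _ _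
  subst h
  rfl

/-- **`Cor_{F/K} ∘ Res_{F/K} = [F : K]`** on `H¹(K, M)` (Serre, *Galois Cohomology* I §2.4 Prop. 9).
[cite: SerreGaloisCohomology1997, I §2.4 Prop. 9] -/
theorem galoisCohomology.cor_res (x : galoisCohomology ρ 1) :
    galoisCohomology.cor ρ F (galoisCohomology.res ρ F 1 x) = Module.finrank K F • x := by
  letI : Fintype (absoluteGaloisGroup K ⧸ (absGaloisRestrict K F).range) := Fintype.ofFinite _
  rw [galoisCohomology.cor_eq_cores_rangeTransport, galoisCohomology.rangeTransport_res,
    cores_resSubgroup, index_range_absGaloisRestrict, Nat.cast_smul_eq_nsmul]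
  rfl

end Cor

end Literature.NumberTheory.GaloisRepresentations

end
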